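import Literature.NumberTheory.Automorphic.AdelicHeightGLSiegel
import Literature.NumberTheory.Automorphic.AutomorphicFormsGLContinuous
import HarnessLib

/-!
# Continuity of the adelic height on `GL_n(𝔸_K)`

Topic `NumberTheory/Automorphic`; namespace `Literature.NumberTheory.Automorphic`. Proof file
(theorems only) for Borel–Jacquet's height `‖g‖ = H_∞(g) ∏_v H_v(g)` (`adelicHeightGL`,
`AdelicGLnGlue`; Borel–Jacquet (1979), §1.2; Moeglin–Waldspurger (1995), I.2.2):

* `GLn.localHeight_mul_eq_of_sndHom_mem` — `H_v(g w) = H_v(g)` when `w_f ∈ GL_n(𝒪̂_K)`;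
* `GLn.continuous_finprod_localHeight` — `g ↦ ∏_v H_v(g)` is locally constant, hence continuous;
* `continuous_adelicHeightGL`, `measurable_adelicHeightGL` — **the height is continuous** (and
  Borel measurable), so that powers of the height may serve as measurable majorants (moderate
  growth weights in unfolding arguments, e.g. Godement–Jacquet (1972), §12).

## References

* A. Borel, H. Jacquet, *Automorphic forms and automorphic representations*, Proc. Sympos. Pure
  Math. 33 (1979), Part 1, §1.2 [BorelJacquetCorvallis1979].
* C. Moeglin, J.-L. Waldspurger, *Spectral decomposition and Eisenstein series* (1995), I.2.2
  [MoeglinWaldspurger1995].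
-/

noncomputable section

open scoped NNReal
open NumberField IsDedekindDomain Set

namespace Literature.NumberTheory.Automorphic

variable {n : ℕ} {K : Type} [Field K] [NumberField K]

/-- **Right `GL_n(𝒪̂_K)`-invariance of the finite local heights**: if `w_f ∈ GL_n(𝒪̂_K)` then
`H_v(g w) = H_v(g)` for every finite `v` (`H_v(g w) ≤ H_v(g) H_v(w) ≤ H_v(g)` and back with `w⁻¹`;
`n ≥ 1`). Borel–Jacquet (1979), §1.2. [cite: BorelJacquetCorvallis1979, §1.2] -/
theorem GLn.localHeight_mul_eq_of_sndHom_mem [NeZero n] (v : HeightOneSpectrum (𝓞 K))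
    (g : GL (Fin n) (AdeleRing (𝓞 K) K)) {w : GL (Fin n) (AdeleRing (𝓞 K) K)}
    (hw : GLn.sndHom n K w ∈ glFiniteIntegralLevel n K) :
    GLn.localHeight n K v (g * w) = GLn.localHeight n K v g := by
  have hw' : GLn.sndHom n K w⁻¹ ∈ glFiniteIntegralLevel n K := by
    rw [map_inv]; exact inv_mem hw
  refine le_antisymm ?_ ?_
  · calc GLn.localHeight n K v (g * w) ≤ GLn.localHeight n K v g * GLn.localHeight n K v w :=
          GLn.localHeight_mul_le v g w
      _ ≤ GLn.localHeight n K v g * 1 := mul_le_mul_right (GLn.localHeight_le_one_of_sndHom_mem hw v) _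
      _ = GLn.localHeight n K v g := mul_one _
  · calc GLn.localHeight n K v g = GLn.localHeight n K v (g * w * w⁻¹) := by rw [mul_inv_cancel_right]
      _ ≤ GLn.localHeight n K v (g * w) * GLn.localHeight n K v w⁻¹ := GLn.localHeight_mul_le v _ _
      _ ≤ GLn.localHeight n K v (g * w) * 1 := mul_le_mul_right (GLn.localHeight_le_one_of_sndHom_mem hw' v) _
      _ = GLn.localHeight n K v (g * w) := mul_one _

/-- **The finite part `∏_v H_v` of the height is locally constant**, hence continuous (it is right
invariant under the open subgroup `{w : w_f ∈ GL_n(𝒪̂_K)}`; `n ≥ 1`). [folklore] -/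
theorem GLn.continuous_finprod_localHeight [NeZero n] :
    Continuous fun g : GL (Fin n) (AdeleRing (𝓞 K) K) => ∏ᶠ v, (GLn.localHeight n K v g : ℝ) := by
  refine (IsLocallyConstant.iff_exists_open _).2 (fun g => ?_) |>.continuous
  refine ⟨{h | GLn.sndHom n K (g⁻¹ * h) ∈ glFiniteIntegralLevel n K}, ?_, ?_, fun h hh => ?_⟩
  · exact (isOpen_glFiniteIntegralLevel n K).preimage (GLn.continuous_sndHom.comp (continuous_const.mul continuous_id))
  · show GLn.sndHom n K (g⁻¹ * g) ∈ glFiniteIntegralLevel n K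
    rw [inv_mul_cancel, map_one]; exact one_mem _
  · have hh' : GLn.sndHom n K (g⁻¹ * h) ∈ glFiniteIntegralLevel n K := hh
    have e : h = g * (g⁻¹ * h) := by rw [mul_inv_cancel_left]
    refine finprod_congr fun v => ?_
    rw [e, GLn.localHeight_mul_eq_of_sndHom_mem v g hh']

/-- **The adelic height `‖g‖ = H_∞(g) ∏_v H_v(g)` is continuous on `GL_n(𝔸_K)`** (`H_∞` is
continuous, `GLn.continuous_archHeight`; the finite part is locally constant). Borel–Jacquet
(1979), §1.2; Moeglin–Waldspurger (1995), I.2.2. [cite: BorelJacquetCorvallis1979, §1.2] -/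
theorem continuous_adelicHeightGL : Continuous (adelicHeightGL n K) := by
  rcases Nat.eq_zero_or_pos n with hn | hn
  · have h : adelicHeightGL n K = fun _ => 0 := funext fun g => adelicHeightGL_eq_zero_of_eq_zero hn g
    rw [h]; exact continuous_const
  haveI : NeZero n := ⟨hn.ne'⟩
  exact (NNReal.continuous_coe.comp (GLn.continuous_archHeight (n := n) (K := K))).mul
    GLn.continuous_finprod_localHeight

/-- The adelic height is Borel measurable. [folklore] -/
theorem measurable_adelicHeightGL [MeasurableSpace (GL (Fin n) (AdeleRing (𝓞 K) K))]
    [BorelSpace (GL (Fin n) (AdeleRing (𝓞 K) K))] : Measurable (adelicHeightGL n K) :=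
  continuous_adelicHeightGL.measurable

end Literature.NumberTheory.Automorphic
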